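import Summits.Ventures.YMGap.RobustBall.MassGapOnBallZdW
import Summits.Ventures.YMGap.RobustBall.StarDoorZdPerturbed
import HarnessLib

/-!
# Venture YMGap, track ROBUST-BALL (tier 2, `ℤ^d`) — the tier-1 gauge-invariant ball sits inside the diameter-weighted
# tier-2 ball

HONEST FRAMING. WHAT THIS IS: a venture file (cell `pub-ymgap`, track Y2 ROBUST-BALL, seat ds-2); bookkeeping: a member
`(W, supp)` of the tier-1 gauge-invariant `ℤ^d` ball `MemBallZdG ε₀ ε₁ R` (finite range `R`, local finiteness) is a member of
the diameter-weighted tier-2 ball `MemBallZdW κ (e^{κR} ε₀) (e^{κR} ε₁)` for every weight `κ ≥ 0` (`MemBallZdG.memBallZdW`: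
the listed sets have link diameter `≤ R`, so the weight costs at most `e^{κR}`); hence a tier-2 row contains the tier-1 row with
deflated loads (`MassGapOnBallZdW.massGapOnBallZdG`, through rb-p1's `perturbedMassGapAtS_iff_of_supportedBy`). WHAT IT IS NOT: no door, no
number; nothing about the continuum.
-/

noncomputable section

open MeasureTheory Function Finset
open Literature.Probability.LatticeModels
open Literature.Probability.LatticeModels.DobrushinMetric
open Literature.MathematicalPhysics.QuantumLattice
open Literature.MathematicalPhysics.QuantumFieldTheory hiding ZdEdge
open Summit.Ventures.YMGap.DSWindowZd

namespace Summit.Ventures.YMGap.RobustBall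

variable {d N : ℕ}

/-- A listed set with a nonzero term has link diameter at most the range `R`. [folklore] -/
theorem MemBallZdG.linkDiamZd_le {ε₀ ε₁ : ℝ} {R : ℕ} {W : Potential (ZdEdge d) (SUN N)}
    {supp : Finset (ZdEdge d) → Finset (Finset (ZdEdge d))} (h : MemBallZdG ε₀ ε₁ R W supp)
    {X : Finset (ZdEdge d)} (hX : W X ≠ 0) : linkDiamZd X ≤ R := by
  classical
  refine Finset.sup_le fun p hp => ?_
  obtain ⟨ha, hb⟩ := Finset.mem_product.1 hp
  have hlist : X ∈ supp {p.1} :=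
    h.supportedBy {p.1} X ⟨p.1, Finset.mem_inter.2 ⟨ha, Finset.mem_singleton_self _⟩⟩ hX
  have hn : ‖p.1.1 - p.2.1‖ ≤ (R : ℝ) := h.range p.1 X hlist ha p.2 hb
  exact Finset.sup_le fun i _ => natAbs_le_of_norm_le hn i

/-- **THE TIER-1 BALL SITS INSIDE THE TIER-2 BALL**: `MemBallZdG ε₀ ε₁ R W supp → MemBallZdW κ (e^{κR} ε₀) (e^{κR} ε₁) W`
for `κ ≥ 0`. [folklore] -/
theorem MemBallZdG.memBallZdW {ε₀ ε₁ κ : ℝ} {R : ℕ} {W : Potential (ZdEdge d) (SUN N)}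
    {supp : Finset (ZdEdge d) → Finset (Finset (ZdEdge d))} (hκ : 0 ≤ κ) (h : MemBallZdG ε₀ ε₁ R W supp) :
    MemBallZdW κ (Real.exp (κ * R) * ε₀) (Real.exp (κ * R) * ε₁) W := by
  classical
  obtain ⟨osc, lip, hosc, hlip, hosce, hlipe⟩ := h.loads
  have hlist : ∀ (e : ZdEdge d) (X : Finset (ZdEdge d)), e ∈ X → W X ≠ 0 → X ∈ supp {e} := fun e X heX h0 =>
    h.supportedBy {e} X ⟨e, Finset.mem_inter.2 ⟨heX, Finset.mem_singleton_self e⟩⟩ h0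
  have hwt : ∀ X : Finset (ZdEdge d), W X ≠ 0 → Real.exp (κ * linkDiamZd X) ≤ Real.exp (κ * R) := fun X hX =>
    Real.exp_le_exp.2 (mul_le_mul_of_nonneg_left (by exact_mod_cast h.linkDiamZd_le hX) hκ)
  set osc' : Finset (ZdEdge d) → ZdEdge d → ℝ := fun X y => if W X = 0 then 0 else osc X y with hosc'
  set lip' : Finset (ZdEdge d) → ZdEdge d → ℝ := fun X y => if W X = 0 then 0 else lip X y with hlip'
  have hosc'B : ∀ X, Dobrushin.IsOscBound (W X) (osc' X) := fun X => by
    by_cases h0 : W X = 0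
    · exact ⟨fun _ => by simp [hosc', h0], fun y σ τ _ => by simp [hosc', h0]⟩
    · exact ⟨fun y => by simp only [hosc', if_neg h0]; exact (hosc X).nonneg y,
        fun y σ τ hστ => by simp only [hosc', if_neg h0]; exact (hosc X).le y σ τ hστ⟩
  have hlip'B : ∀ X, IsLipBound suFrobDist (W X) (lip' X) := fun X => by
    by_cases h0 : W X = 0
    · exact ⟨fun _ => by simp [hlip', h0], fun y σ τ _ => by simp [hlip', h0]⟩
    · exact ⟨fun y => by simp only [hlip', if_neg h0]; exact (hlip X).nonneg y,
        fun y σ τ hστ => by simp only [hlip', if_neg h0]; exact (hlip X).le y σ τ hστ⟩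
  -- the oscillation terms vanish off `supp {e}` and are dominated on it
  have hoz : ∀ (e : ZdEdge d), ∀ X ∉ supp {e},
      (if e ∈ X then Real.exp (κ * linkDiamZd X) * osc' X e else 0) = 0 := by
    intro e X hX
    by_cases heX : e ∈ X
    · by_cases h0 : W X = 0
      · simp [hosc', h0]
      · exact absurd (hlist e X heX h0) hX
    · simp [heX]
  have hole : ∀ (e : ZdEdge d) (X : Finset (ZdEdge d)),
      (if e ∈ X then Real.exp (κ * linkDiamZd X) * osc' X e else 0) ≤
        Real.exp (κ * R) * (if e ∈ X then osc X e else 0) := by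
    intro e X
    by_cases heX : e ∈ X
    · simp only [if_pos heX, hosc']
      by_cases h0 : W X = 0
      · simp only [if_pos h0, mul_zero]; exact mul_nonneg (Real.exp_nonneg _) ((hosc X).nonneg e)
      · simp only [if_neg h0]; exact mul_le_mul_of_nonneg_right (hwt X h0) ((hosc X).nonneg e)
    · simp [heX]
  -- the Lipschitz site terms vanish off `listedAt supp v` and are dominated on it
  have hlz : ∀ (v : Site d), ∀ X ∉ listedAt supp v,
      (if (∃ μ : Fin d, ((v, μ) : ZdEdge d) ∈ X) then Real.exp (κ * linkDiamZd X) * ∑ y ∈ X, lip' X y else 0) = 0 := by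
    intro v X hX
    by_cases hv : ∃ μ : Fin d, ((v, μ) : ZdEdge d) ∈ X
    · by_cases h0 : W X = 0
      · simp [hlip', h0]
      · obtain ⟨μ, hμ⟩ := hv
        exact absurd (mem_listedAt_of_ne_zero h.supportedBy h0 hμ) hX
    · simp [hv]
  have hlle : ∀ (v : Site d) (X : Finset (ZdEdge d)),
      (if (∃ μ : Fin d, ((v, μ) : ZdEdge d) ∈ X) then Real.exp (κ * linkDiamZd X) * ∑ y ∈ X, lip' X y else 0) ≤
        Real.exp (κ * R) * ∑ y ∈ X, lip X y := by
    intro v X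
    have hs0 : 0 ≤ ∑ y ∈ X, lip X y := Finset.sum_nonneg fun y _ => (hlip X).nonneg y
    by_cases hv : ∃ μ : Fin d, ((v, μ) : ZdEdge d) ∈ X
    · simp only [if_pos hv, hlip']
      by_cases h0 : W X = 0
      · simp only [if_pos h0, Finset.sum_const_zero, mul_zero]; exact mul_nonneg (Real.exp_nonneg _) hs0
      · simp only [if_neg h0]; exact mul_le_mul_of_nonneg_right (hwt X h0) hs0
    · simp only [if_neg hv]; exact mul_nonneg (Real.exp_nonneg _) hs0
  refine ⟨h.continuous, h.dependsOn, h.gaugeInvariant, h.memBallZd.isLinkSummable, osc', lip', hosc'B, hlip'B,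
    fun e => summable_of_ne_finset_zero (hoz e), fun e => ?_, fun v => summable_of_ne_finset_zero (hlz v), fun v => ?_⟩
  · rw [tsum_eq_sum (s := supp {e}) (hoz e)]
    calc ∑ X ∈ supp {e}, (if e ∈ X then Real.exp (κ * linkDiamZd X) * osc' X e else 0)
        ≤ ∑ X ∈ supp {e}, Real.exp (κ * R) * (if e ∈ X then osc X e else 0) := Finset.sum_le_sum fun X _ => hole e X
      _ = Real.exp (κ * R) * ∑ X ∈ (supp {e}).filter (fun X => e ∈ X), osc X e := by
          rw [← Finset.mul_sum, Finset.sum_filter]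
      _ ≤ Real.exp (κ * R) * ε₀ := mul_le_mul_of_nonneg_left (hosce e) (Real.exp_nonneg _)
  · rw [tsum_eq_sum (s := listedAt supp v) (hlz v)]
    calc ∑ X ∈ listedAt supp v,
          (if (∃ μ : Fin d, ((v, μ) : ZdEdge d) ∈ X) then Real.exp (κ * linkDiamZd X) * ∑ y ∈ X, lip' X y else 0)
        ≤ ∑ X ∈ listedAt supp v, Real.exp (κ * R) * ∑ y ∈ X, lip X y := Finset.sum_le_sum fun X _ => hlle v X
      _ = Real.exp (κ * R) * ∑ X ∈ listedAt supp v, ∑ y ∈ X, lip X y := by rw [← Finset.mul_sum]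
      _ ≤ Real.exp (κ * R) * ε₁ := mul_le_mul_of_nonneg_left (hlipe v) (Real.exp_nonneg _)

/-- **A TIER-2 ROW CONTAINS THE TIER-1 ROW WITH DEFLATED LOADS**: `MassGapOnBallZdW d N β κ ε₀ ε₁` (`κ ≥ 0`) gives
`MassGapOnBallZdG d N β ε₀' ε₁' R` whenever `e^{κR} ε₀' ≤ ε₀` and `e^{κR} ε₁' ≤ ε₁`. [folklore] -/
theorem MassGapOnBallZdW.massGapOnBallZdG {β κ ε₀ ε₁ ε₀' ε₁' : ℝ} {R : ℕ} (hκ : 0 ≤ κ)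
    (h₀ : Real.exp (κ * R) * ε₀' ≤ ε₀) (h₁ : Real.exp (κ * R) * ε₁' ≤ ε₁) (h : MassGapOnBallZdW d N β κ ε₀ ε₁) :
    MassGapOnBallZdG d N β ε₀' ε₁' R := by
  intro W supp hW
  have hW2 : MemBallZdW κ ε₀ ε₁ W := ((hW.memBallZdW hκ).mono h₀ h₁)
  exact (perturbedMassGapAtS_iff_of_supportedBy β hW.supportedBy).1 (h W hW2)

end Summit.Ventures.YMGap.RobustBall

end
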